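import Summits.Ventures.PercRepro.ProfilePointedCircuitClassesInOutLYM
import Summits.Ventures.PercRepro.ProfileTwoTop

/-!
# PercRepro — THE SPANNING `5`-SETS OF `S ∪ Y` IN A RANK-`4` MATROID, I: THE LABELS AND THE INDEPENDENT LABELS
(p5, gen 41; `proofs/P5-GM1.md` §60)

`M` is a finite matroid of rank `4` (the dual of a matroid of nullity `4`), `S` a spanning `5`-set and `Y` a set of
further points.  A `5`-subset `X` of `S ∪ Y` is LABELLED by `(k, Z, A)` with `Z := X ∩ Y ∈ C(Y, k)` and
`A := S ∖ X ∈ C(S, k)`, and `X = (S ∖ A) ∪ Z`; so the spanning `5`-sets are at least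
`Σ_{k < 4} Σ_{Z ∈ C(Y,k)} g(Z)` with `g(Z) := #{A ∈ C(S, #Z) : (S ∖ A) ∪ Z spans}`
(`sum_card_filter_le_card_spanning_five`).  For an INDEPENDENT `Z` with `#Z ≤ 4`, `Z` extends to a basis `B ⊆ S ∪ Z`
(`exists_indep_between`) and every `A ∈ C(S, #Z)` avoiding the `4 − #Z` points of `B ∖ Z` has `(S ∖ A) ∪ Z ⊇ B`
spanning: `g(Z) ≥ C(#Z + 1, #Z) = #Z + 1` (`succ_card_le_card_filter_of_indep`) — the statements (Q) and (R) of
§59 ADDENDUM 7 with no case analysis.  The level sums: `g(∅) = 1` (`sum_powersetCard_zero_eq_one`), the level-`1`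
sum in point form (`sum_powersetCard_one_eq`), and the pointwise bounds `Σ_{C(Y,2)} g ≥ 3·ι₂(Y)`,
`Σ_{C(Y,3)} g ≥ ι₃(Y)` (`three_mul_card_filter_le_sum_two`, `card_filter_le_sum_three`).
-/

open scoped Matroid

namespace PercRepro.Cogirth

open Finset ThmH Skew Shadow Profile

variable {α : Type} [DecidableEq α] {M : Matroid α} [M.Finite]

section StarStarA

/-! ### Basis extension inside a set -/

/-- **One more point inside `T`**: an independent `Z ⊆ T` of rank below `ρ(T)` extends by a point of `T ∖ Z`. -/
theorem exists_insert_rk_eq_card_of_rk_lt_rk {Z T : Finset α} (hT : T ⊆ gr M) (hZT : Z ⊆ T)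
    (hZ : rk M Z = Z.card) (hlt : rk M Z < rk M T) :
    ∃ x ∈ T, x ∉ Z ∧ rk M (insert x Z) = (insert x Z).card := by
  by_contra hcon
  simp only [not_exists, not_and] at hcon
  have hZg : Z ⊆ gr M := hZT.trans hT
  have hsub : T ⊆ clF M Z := by
    intro x hx
    by_cases hxZ : x ∈ Z
    · exact mem_clF_of_mem_of_subset_gr hZg hxZ
    · have h := hcon x hx hxZ
      rw [rk_insert_eq (hT hx) hZg] at h
      split_ifs at h with hcl
      · exact hcl
      · exact absurd (by rw [card_insert_of_notMem hxZ, hZ]) h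
  have := rk_le_rk_of_subset_clF hsub
  omega

/-- **Basis extension inside a spanning set**: an independent `Z ⊆ T` with `ρ(T) = ρ(E)` extends to an independent
`B` with `Z ⊆ B ⊆ T` and `#B = ρ(E)`. -/
theorem exists_indep_between {Z T : Finset α} (hT : T ⊆ gr M) (hZT : Z ⊆ T) (hZ : rk M Z = Z.card)
    (hTsp : rk M T = rk M (gr M)) :
    ∃ B, Z ⊆ B ∧ B ⊆ T ∧ B.card = rk M (gr M) ∧ rk M B = B.card := by
  suffices h : ∀ j, Z.card + j ≤ rk M (gr M) →
      ∃ B, Z ⊆ B ∧ B ⊆ T ∧ B.card = Z.card + j ∧ rk M B = B.card by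
    have hZle : Z.card ≤ rk M (gr M) := by
      have := rk_le_rk_gr (M := M) (hZT.trans hT)
      omega
    obtain ⟨B, h1, h2, h3, h4⟩ := h (rk M (gr M) - Z.card) (by omega)
    exact ⟨B, h1, h2, by omega, h4⟩
  intro j
  induction j with
  | zero => intro _; exact ⟨Z, Subset.refl _, hZT, by simp, hZ⟩
  | succ j ih =>
    intro hj
    obtain ⟨B, hZB, hBT, hBc, hBr⟩ := ih (by omega)
    obtain ⟨x, hxT, hxB, hxr⟩ :=
      exists_insert_rk_eq_card_of_rk_lt_rk hT hBT hBr (by rw [hBr, hBc, hTsp]; omega)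
    refine ⟨insert x B, hZB.trans (subset_insert x B), insert_subset hxT hBT, ?_, hxr⟩
    rw [card_insert_of_notMem hxB, hBc]
    omega

/-! ### The independent labels -/

/-- **The independent labels**: for an independent `Z ⊆ Y` with `#Z ≤ 4`, at least `#Z + 1` sets `A ∈ C(S, #Z)`
have `(S ∖ A) ∪ Z` spanning — the `#Z`-subsets of `S` avoiding the `4 − #Z` points completing `Z` to a basis
inside `S ∪ Z`. -/
theorem succ_card_le_card_filter_of_indep (hR : rk M (gr M) = 4) {S Y : Finset α} (hS : S ⊆ gr M)
    (hS5 : S.card = 5) (hSsp : rk M S = 4) (hY : Y ⊆ gr M \ S) {Z : Finset α} (hZY : Z ⊆ Y)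
    (hZ4 : Z.card ≤ 4) (hZi : rk M Z = Z.card) :
    Z.card + 1 ≤ ((S.powersetCard Z.card).filter (fun A => rk M ((S \ A) ∪ Z) = 4)).card := by
  have hYg : Y ⊆ gr M := hY.trans sdiff_subset
  have hZg : Z ⊆ gr M := hZY.trans hYg
  have hT : S ∪ Z ⊆ gr M := union_subset hS hZg
  have hTsp : rk M (S ∪ Z) = rk M (gr M) := by
    have h1 := rk_mono' (M := M) (subset_union_left (s₁ := S) (s₂ := Z))
    have h2 := rk_le_rk_gr (M := M) hT
    omega
  obtain ⟨B, hZB, hBT, hBc, hBr⟩ := exists_indep_between hT subset_union_right hZi hTsp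
  rw [hR] at hBc
  have hDS : B \ Z ⊆ S := by
    intro d hd
    rw [mem_sdiff] at hd
    rcases mem_union.1 (hBT hd.1) with h | h
    · exact h
    · exact absurd h hd.2
  have hDc : (B \ Z).card = 4 - Z.card := by rw [card_sdiff_of_subset hZB, hBc]
  have hsub : (S \ (B \ Z)).powersetCard Z.card ⊆
      (S.powersetCard Z.card).filter (fun A => rk M ((S \ A) ∪ Z) = 4) := by
    intro A hA
    rw [mem_powersetCard] at hA
    rw [mem_filter, mem_powersetCard]
    refine ⟨⟨hA.1.trans sdiff_subset, hA.2⟩, ?_⟩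
    have hBsub : B ⊆ (S \ A) ∪ Z := by
      intro b hb
      rw [mem_union]
      by_cases hbZ : b ∈ Z
      · exact Or.inr hbZ
      · refine Or.inl (mem_sdiff.2 ⟨hDS (mem_sdiff.2 ⟨hb, hbZ⟩), fun hbA => ?_⟩)
        have := hA.1 hbA
        rw [mem_sdiff] at this
        exact this.2 (mem_sdiff.2 ⟨hb, hbZ⟩)
    have h1 := rk_mono' (M := M) hBsub
    have h2 : rk M ((S \ A) ∪ Z) ≤ rk M (gr M) :=
      rk_le_rk_gr (union_subset ((sdiff_subset (s := S) (t := A)).trans hS) hZg)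
    omega
  calc Z.card + 1 = ((S \ (B \ Z)).powersetCard Z.card).card := by
        rw [card_powersetCard, card_sdiff_of_subset hDS, hDc, hS5,
          show 5 - (4 - Z.card) = Z.card + 1 by omega, Nat.choose_succ_self_right]
    _ ≤ _ := card_le_card hsub

/-! ### The labels inject into the spanning `5`-sets -/

/-- **The labels inject into the spanning `5`-sets**:
`Σ_{k<4} Σ_{Z ∈ C(Y,k)} #{A ∈ C(S,k) : (S ∖ A) ∪ Z spans} ≤ #{X ∈ C(S ∪ Y, 5) : X spans}` for `#S = 5`, `S ∩ Y = ∅`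
(the label `(k, Z, A)` is read off `X = (S ∖ A) ∪ Z` as `Z = X ∩ Y`, `A = S ∖ X`). -/
theorem sum_card_filter_le_card_spanning_five {S Y : Finset α} (hS5 : S.card = 5) (hSY : Disjoint S Y) :
    (∑ k ∈ range 4, ∑ Z ∈ Y.powersetCard k,
        ((S.powersetCard k).filter (fun A => rk M ((S \ A) ∪ Z) = 4)).card) ≤
      (((S ∪ Y).powersetCard 5).filter (fun X => rk M X = 4)).card := by
  have hL : (∑ k ∈ range 4, ∑ Z ∈ Y.powersetCard k,
        ((S.powersetCard k).filter (fun A => rk M ((S \ A) ∪ Z) = 4)).card) =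
      ((range 4).sigma (fun k => (Y.powersetCard k).sigma
        (fun Z => (S.powersetCard k).filter (fun A => rk M ((S \ A) ∪ Z) = 4)))).card := by
    rw [card_sigma]
    apply sum_congr rfl
    intro k _
    rw [card_sigma]
  rw [hL]
  apply card_le_card_of_injOn (fun p => (S \ p.2.2) ∪ p.2.1)
  · rintro ⟨k, Z, A⟩ hp
    rw [mem_coe, mem_sigma, mem_sigma, mem_filter, mem_powersetCard, mem_powersetCard] at hp
    obtain ⟨_, ⟨hZY, hZk⟩, ⟨hAS, hAk⟩, hr⟩ := hp
    rw [mem_coe, mem_filter, mem_powersetCard]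
    refine ⟨⟨union_subset_union sdiff_subset hZY, ?_⟩, hr⟩
    have hAle := card_le_card hAS
    rw [card_union_of_disjoint ((hSY.mono_left sdiff_subset).mono_right hZY), card_sdiff_of_subset hAS,
      hAk, hZk, hS5]
    omega
  · rintro ⟨k, Z, A⟩ hp ⟨k', Z', A'⟩ hq hpq
    rw [mem_coe, mem_sigma, mem_sigma, mem_filter, mem_powersetCard, mem_powersetCard] at hp hq
    simp only at hp hq
    obtain ⟨_, ⟨hZY, hZk⟩, ⟨hAS, _⟩, _⟩ := hp
    obtain ⟨_, ⟨hZY', hZk'⟩, ⟨hAS', _⟩, _⟩ := hq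
    simp only at hpq
    -- `Z` is read off as `X ∩ Y`
    have hZrec : ∀ (Z₀ A₀ : Finset α), Z₀ ⊆ Y → A₀ ⊆ S → ((S \ A₀) ∪ Z₀) ∩ Y = Z₀ := by
      intro Z₀ A₀ hZ₀ hA₀
      ext x
      rw [mem_inter, mem_union, mem_sdiff]
      constructor
      · rintro ⟨h | h, hxY⟩
        · exact absurd hxY (disjoint_left.1 hSY h.1)
        · exact h
      · intro hx
        exact ⟨Or.inr hx, hZ₀ hx⟩
    -- `A` is read off as `S ∖ X`
    have hArec : ∀ (Z₀ A₀ : Finset α), Z₀ ⊆ Y → A₀ ⊆ S → S \ ((S \ A₀) ∪ Z₀) = A₀ := by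
      intro Z₀ A₀ hZ₀ hA₀
      ext x
      rw [mem_sdiff, mem_union, mem_sdiff, not_or, not_and, not_not]
      constructor
      · rintro ⟨hxS, h1, _⟩
        exact h1 hxS
      · intro hx
        exact ⟨hA₀ hx, fun _ => hx, fun hxZ => disjoint_left.1 hSY (hA₀ hx) (hZ₀ hxZ)⟩
    have hZ : Z = Z' := by
      rw [← hZrec Z A hZY hAS, ← hZrec Z' A' hZY' hAS', hpq]
    have hA : A = A' := by
      rw [← hArec Z A hZY hAS, ← hArec Z' A' hZY' hAS', hpq]
    have hk : k = k' := by rw [← hZk, ← hZk', hZ]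
    subst hZ
    subst hA
    subst hk
    rfl

/-! ### The level sums -/

/-- Level `0` of the label sum: `g(∅) = 1` when `S` spans. -/
theorem sum_powersetCard_zero_eq_one {S Y : Finset α} (hSsp : rk M S = 4) :
    (∑ Z ∈ Y.powersetCard 0, ((S.powersetCard 0).filter (fun A => rk M ((S \ A) ∪ Z) = 4)).card) = 1 := by
  have h : rk M ((S \ ∅) ∪ ∅) = 4 := by rw [sdiff_empty, union_empty]; exact hSsp
  rw [powersetCard_zero, sum_singleton, powersetCard_zero, filter_singleton, if_pos h, card_singleton]

/-- Level `1` of the label sum in point form: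
`Σ_{Z ∈ C(Y,1)} g(Z) = Σ_{y ∈ Y} #{s ∈ S : (S − s) + y spans}`. -/
theorem sum_powersetCard_one_eq {S Y : Finset α} :
    (∑ Z ∈ Y.powersetCard 1, ((S.powersetCard 1).filter (fun A => rk M ((S \ A) ∪ Z) = 4)).card) =
      ∑ y ∈ Y, (S.filter (fun s => rk M (insert y (S.erase s)) = 4)).card := by
  rw [powersetCard_one, sum_map]
  apply sum_congr rfl
  intro y _
  rw [powersetCard_one, filter_map, card_map]
  congr 1
  apply filter_congr
  intro s _
  simp only [Function.Embedding.coeFn_mk, Function.comp]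
  rw [sdiff_singleton_eq_erase, union_comm, ← insert_eq]

/-- Level `2`, pointwise: `3·ι₂(Y) ≤ Σ_{Z ∈ C(Y,2)} g(Z)`. -/
theorem three_mul_card_filter_le_sum_two (hR : rk M (gr M) = 4) {S Y : Finset α} (hS : S ⊆ gr M)
    (hS5 : S.card = 5) (hSsp : rk M S = 4) (hY : Y ⊆ gr M \ S) :
    3 * ((Y.powersetCard 2).filter (fun Z => rk M Z = 2)).card ≤
      ∑ Z ∈ Y.powersetCard 2, ((S.powersetCard 2).filter (fun A => rk M ((S \ A) ∪ Z) = 4)).card := by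
  have e : ((Y.powersetCard 2).filter (fun Z => rk M Z = 2)).card =
      ∑ Z ∈ Y.powersetCard 2, if rk M Z = 2 then 1 else 0 := card_filter _ _
  rw [e, mul_sum]
  apply sum_le_sum
  intro Z hZ
  rw [mem_powersetCard] at hZ
  split_ifs with h
  · have := succ_card_le_card_filter_of_indep hR hS hS5 hSsp hY hZ.1 (by omega) (by rw [h, hZ.2])
    rw [hZ.2] at this
    omega
  · omega

/-- Level `3`, pointwise: `ι₃(Y) ≤ Σ_{Z ∈ C(Y,3)} g(Z)`. -/
theorem card_filter_le_sum_three (hR : rk M (gr M) = 4) {S Y : Finset α} (hS : S ⊆ gr M)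
    (hS5 : S.card = 5) (hSsp : rk M S = 4) (hY : Y ⊆ gr M \ S) :
    ((Y.powersetCard 3).filter (fun Z => rk M Z = 3)).card ≤
      ∑ Z ∈ Y.powersetCard 3, ((S.powersetCard 3).filter (fun A => rk M ((S \ A) ∪ Z) = 4)).card := by
  have e : ((Y.powersetCard 3).filter (fun Z => rk M Z = 3)).card =
      ∑ Z ∈ Y.powersetCard 3, if rk M Z = 3 then 1 else 0 := card_filter _ _
  rw [e]
  apply sum_le_sum
  intro Z hZ
  rw [mem_powersetCard] at hZ
  split_ifs with h
  · have := succ_card_le_card_filter_of_indep hR hS hS5 hSsp hY hZ.1 (by omega) (by rw [h, hZ.2])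
    rw [hZ.2] at this
    omega
  · omega

/-- Level `1`, pointwise: if every point `y ∈ Y` has at least three `s ∈ S` with `(S − s) + y` spanning, then
`3·#Y ≤ Σ_{y ∈ Y} #{s ∈ S : (S − s) + y spans}`. -/
theorem three_mul_card_le_sum_one {S Y : Finset α}
    (h : ∀ y ∈ Y, 3 ≤ (S.filter (fun s => rk M (insert y (S.erase s)) = 4)).card) :
    3 * Y.card ≤ ∑ y ∈ Y, (S.filter (fun s => rk M (insert y (S.erase s)) = 4)).card := by
  have := card_nsmul_le_sum Y (fun y => (S.filter (fun s => rk M (insert y (S.erase s)) = 4)).card) 3 h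
  rw [smul_eq_mul] at this
  omega

/-- **A sum with one extra term**: if `g ≤ f` pointwise on `s` and `g i₀ + c ≤ f i₀` at one `i₀ ∈ s`, then
`Σ g + c ≤ Σ f`. -/
theorem sum_add_le_sum_of_le_of_add_le {ι : Type} [DecidableEq ι] {s : Finset ι} {f g : ι → ℕ}
    (h : ∀ i ∈ s, g i ≤ f i) {i₀ : ι} (hi₀ : i₀ ∈ s) {c : ℕ} (hc : g i₀ + c ≤ f i₀) :
    (∑ i ∈ s, g i) + c ≤ ∑ i ∈ s, f i := by
  rw [← add_sum_erase s f hi₀, ← add_sum_erase s g hi₀]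
  have : ∑ i ∈ s.erase i₀, g i ≤ ∑ i ∈ s.erase i₀, f i :=
    sum_le_sum (fun i hi => h i (mem_of_mem_erase hi))
  omega

end StarStarA

end PercRepro.Cogirth
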